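import Summits.Ventures.PercRepro.RankDistTopClosed
import Mathlib.Combinatorics.Matroid.IndepAxioms

/-!
# PercRepro — THE BOOK MATROID `B_k`: `k` triangles on a common edge, as a matroid on any type (p9, gen 23)

`B_k` is the cycle matroid of the graph with vertices `0, 1, x_1, …, x_k` and edges `e₀ = (0,1)`, `a_i = (0,x_i)`,
`b_i = (1,x_i)` — `k` triangles `{e₀, a_i, b_i}` on the common edge `e₀`; its circuits are those triangles and the
4-cycles `{a_i, b_i, a_j, b_j}`. We present it on an arbitrary type through an injection
`f : Option (Fin k × Bool) → α` (`f none = e₀`, `f (some (i, false)) = a_i`, `f (some (i, true)) = b_i`): a set `A`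
is independent iff `A ⊆ range f` and `[e₀ ∈ A] + #{full pairs of A} ≤ 1` (no triangle and no 4-cycle inside `A`).
* `bookSp` / `bookHit` / `bookMiss` / `bookFull` — the pattern of a set: `[e₀ ∈ A]`, the pairs hit / missed / fully
  contained;
* `ncard_eq_pattern` — `|A| = [e₀ ∈ A] + #hit + #full` for `A ⊆ range f`;
* `book f hf` — the matroid (`IndepMatroid.ofFinite`; the augmentation axiom by the pattern count);
`RankDistBookRank` computes the rank from the pattern (`ρ(A) = #hit + min(1, [e₀ ∈ A] + #full)`),
`RankDistBookProfile` counts the tight layer `(k + 1, k)` of `B_k`, and `RankDistBookSum` refutes the row (SC) on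
`B_11 ⊕ B_12`. Nothing here moves any window of the crux.
-/

namespace PercRepro.RankDist

open Set Finset _root_.Matroid PercRepro.ThmH

variable {α : Type} {k : ℕ} (f : Option (Fin k × Bool) → α)

/-! ## The pattern of a set -/

open scoped Classical in
/-- `[e₀ ∈ A]`. -/
noncomputable def bookSp (A : Set α) : ℕ := if f none ∈ A then 1 else 0

open scoped Classical in
/-- The pairs hit by `A`. -/
noncomputable def bookHit (A : Set α) : Finset (Fin k) :=
  Finset.univ.filter (fun i => f (some (i, false)) ∈ A ∨ f (some (i, true)) ∈ A)

open scoped Classical in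
/-- The pairs missed by `A`. -/
noncomputable def bookMiss (A : Set α) : Finset (Fin k) :=
  Finset.univ.filter (fun i => f (some (i, false)) ∉ A ∧ f (some (i, true)) ∉ A)

open scoped Classical in
/-- The pairs fully contained in `A`. -/
noncomputable def bookFull (A : Set α) : Finset (Fin k) :=
  Finset.univ.filter (fun i => f (some (i, false)) ∈ A ∧ f (some (i, true)) ∈ A)

/-- Independence in the book: no triangle, no 4-cycle. -/
def BookIndep (A : Set α) : Prop := A ⊆ Set.range f ∧ bookSp f A + (bookFull f A).card ≤ 1

/-- `[e₀ ∈ A] ≤ 1`. -/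
lemma bookSp_le_one (A : Set α) : bookSp f A ≤ 1 := by
  unfold bookSp; split_ifs <;> omega

/-- `[e₀ ∈ A] = 1` iff `e₀ ∈ A`. -/
lemma bookSp_eq_one_iff (A : Set α) : bookSp f A = 1 ↔ f none ∈ A := by
  unfold bookSp; split_ifs with h <;> simp [h]

/-- `[e₀ ∈ A] = 0` iff `e₀ ∉ A`. -/
lemma bookSp_eq_zero_iff (A : Set α) : bookSp f A = 0 ↔ f none ∉ A := by
  unfold bookSp; split_ifs with h <;> simp [h]

/-- Membership in `bookHit`. -/
lemma mem_bookHit {A : Set α} {i : Fin k} :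
    i ∈ bookHit f A ↔ f (some (i, false)) ∈ A ∨ f (some (i, true)) ∈ A := by
  unfold bookHit; simp

/-- Membership in `bookMiss`. -/
lemma mem_bookMiss {A : Set α} {i : Fin k} :
    i ∈ bookMiss f A ↔ f (some (i, false)) ∉ A ∧ f (some (i, true)) ∉ A := by
  unfold bookMiss; simp

/-- Membership in `bookFull`. -/
lemma mem_bookFull {A : Set α} {i : Fin k} :
    i ∈ bookFull f A ↔ f (some (i, false)) ∈ A ∧ f (some (i, true)) ∈ A := by
  unfold bookFull; simp

/-- A full pair is hit. -/
lemma bookFull_subset_bookHit (A : Set α) : bookFull f A ⊆ bookHit f A := by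
  intro i hi
  rw [mem_bookFull] at hi
  rw [mem_bookHit]
  exact Or.inl hi.1

/-- Every pair is hit or missed: `#hit + #miss = k`. -/
lemma card_bookHit_add_card_bookMiss (A : Set α) : (bookHit f A).card + (bookMiss f A).card = k := by
  classical
  have h := Finset.card_filter_add_card_filter_not
    (s := (Finset.univ : Finset (Fin k))) (p := fun i => f (some (i, false)) ∈ A ∨ f (some (i, true)) ∈ A)
  rw [Finset.card_univ, Fintype.card_fin] at h
  have e1 : bookHit f A = Finset.univ.filter (fun i => f (some (i, false)) ∈ A ∨ f (some (i, true)) ∈ A) := rfl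
  have e2 : bookMiss f A
      = Finset.univ.filter (fun i => ¬ (f (some (i, false)) ∈ A ∨ f (some (i, true)) ∈ A)) := by
    ext i
    simp only [mem_bookMiss, Finset.mem_filter, Finset.mem_univ, true_and, not_or]
  rw [e1, e2]
  exact h

/-- `bookHit` is monotone. -/
lemma bookHit_mono {A A' : Set α} (h : A ⊆ A') : bookHit f A ⊆ bookHit f A' := by
  intro i hi
  rw [mem_bookHit] at hi ⊢
  exact hi.imp (fun h1 => h h1) (fun h1 => h h1)

/-- `bookFull` is monotone. -/
lemma bookFull_mono {A A' : Set α} (h : A ⊆ A') : bookFull f A ⊆ bookFull f A' := by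
  intro i hi
  rw [mem_bookFull] at hi ⊢
  exact ⟨h hi.1, h hi.2⟩

/-- `bookSp` is monotone. -/
lemma bookSp_mono {A A' : Set α} (h : A ⊆ A') : bookSp f A ≤ bookSp f A' := by
  unfold bookSp
  split_ifs with h1 h2
  · exact le_rfl
  · exact absurd (h h1) h2
  · omega
  · exact le_rfl

/-! ## The size of a set from its pattern -/

open scoped Classical in
/-- The fibre of a pair: the elements of `A` in the pair `i`, counted. -/
lemma card_filter_pair (A : Set α) (i : Fin k) :
    ((Finset.univ.filter (fun x : Option (Fin k × Bool) => f x ∈ A)).filter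
        (fun x => Option.map Prod.fst x = some i)).card
      = (if i ∈ bookHit f A then 1 else 0) + (if i ∈ bookFull f A then 1 else 0) := by
  have hset : (Finset.univ.filter (fun x : Option (Fin k × Bool) => f x ∈ A)).filter
        (fun x => Option.map Prod.fst x = some i)
      = ({some (i, false), some (i, true)} : Finset (Option (Fin k × Bool))).filter (fun x => f x ∈ A) := by
    ext x
    simp only [Finset.mem_filter, Finset.mem_univ, true_and, Finset.mem_insert, Finset.mem_singleton]
    constructor
    · rintro ⟨hA, hx⟩
      refine ⟨?_, hA⟩
      rcases x with _ | ⟨j, b⟩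
      · simp at hx
      · simp only [Option.map_some, Option.some.injEq] at hx
        subst hx
        cases b <;> simp
    · rintro ⟨hx, hA⟩
      refine ⟨hA, ?_⟩
      rcases hx with rfl | rfl <;> simp
  rw [hset, Finset.filter_insert, Finset.filter_singleton]
  have hne : (some (i, false) : Option (Fin k × Bool)) ≠ some (i, true) := by simp
  by_cases h0 : f (some (i, false)) ∈ A <;> by_cases h1 : f (some (i, true)) ∈ A <;>
    simp [h0, h1, mem_bookHit, mem_bookFull, Finset.card_pair hne]

/-- **The size of a set from its pattern**: `|A| = [e₀ ∈ A] + #hit + #full` for `A ⊆ range f`. -/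
theorem ncard_eq_pattern (hf : Function.Injective f) {A : Set α} (hA : A ⊆ Set.range f) :
    A.ncard = bookSp f A + (bookHit f A).card + (bookFull f A).card := by
  classical
  set S : Finset (Option (Fin k × Bool)) := Finset.univ.filter (fun x => f x ∈ A) with hS
  have hAS : A = f '' (S : Set (Option (Fin k × Bool))) := by
    ext y
    constructor
    · intro hy
      obtain ⟨x, rfl⟩ := hA hy
      exact ⟨x, by simp [hS, hy], rfl⟩
    · rintro ⟨x, hx, rfl⟩
      simpa [hS] using hx
  have h1 : A.ncard = S.card := by
    rw [hAS, Set.ncard_image_of_injective _ hf, Set.ncard_coe_finset]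
  rw [h1, Finset.card_eq_sum_card_fiberwise (f := fun x => Option.map Prod.fst x)
    (t := (Finset.univ : Finset (Option (Fin k)))) (fun _ _ => Finset.mem_univ _)]
  rw [Fintype.sum_option]
  have hnone : (S.filter (fun x => Option.map Prod.fst x = (none : Option (Fin k)))).card = bookSp f A := by
    have : S.filter (fun x => Option.map Prod.fst x = (none : Option (Fin k)))
        = ({none} : Finset (Option (Fin k × Bool))).filter (fun x => f x ∈ A) := by
      ext x
      simp only [hS, Finset.mem_filter, Finset.mem_univ, true_and, Finset.mem_singleton]
      constructor
      · rintro ⟨hA', hx⟩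
        refine ⟨?_, hA'⟩
        rcases x with _ | ⟨j, b⟩
        · rfl
        · simp at hx
      · rintro ⟨rfl, hA'⟩
        exact ⟨hA', rfl⟩
    rw [this, Finset.filter_singleton]
    unfold bookSp
    split_ifs <;> simp
  have hsome : ∀ i : Fin k, (S.filter (fun x => Option.map Prod.fst x = some i)).card
      = (if i ∈ bookHit f A then 1 else 0) + (if i ∈ bookFull f A then 1 else 0) := by
    intro i
    rw [hS]
    exact card_filter_pair f A i
  rw [hnone]
  simp_rw [hsome]
  rw [Finset.sum_add_distrib, ← Finset.card_filter, ← Finset.card_filter]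
  have e1 : (Finset.univ.filter (fun i : Fin k => i ∈ bookHit f A)) = bookHit f A := by
    ext i; simp
  have e2 : (Finset.univ.filter (fun i : Fin k => i ∈ bookFull f A)) = bookFull f A := by
    ext i; simp
  rw [e1, e2]
  ring

/-! ## Inserting one element -/

/-- Inserting an element other than `e₀` does not change `[e₀ ∈ A]`. -/
lemma bookSp_insert_of_ne {I : Set α} {e : α} (he : e ≠ f none) : bookSp f (insert e I) = bookSp f I := by
  unfold bookSp
  by_cases h : f none ∈ I
  · rw [if_pos (Set.mem_insert_of_mem _ h), if_pos h]
  · rw [if_neg (fun h' => ?_), if_neg h]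
    rcases Set.mem_insert_iff.1 h' with h'' | h''
    · exact he h''.symm
    · exact h h''

/-- Inserting `e₀` makes `[e₀ ∈ A] = 1`. -/
lemma bookSp_insert_none (I : Set α) : bookSp f (insert (f none) I) = 1 := by
  rw [bookSp_eq_one_iff]; exact Set.mem_insert _ _

/-- Inserting `e₀` does not change the full pairs. -/
lemma bookFull_insert_none (hf : Function.Injective f) (I : Set α) :
    bookFull f (insert (f none) I) = bookFull f I := by
  ext i
  simp only [mem_bookFull, Set.mem_insert_iff]
  have h1 : f (some (i, false)) ≠ f none := fun h => by simpa using hf h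
  have h2 : f (some (i, true)) ≠ f none := fun h => by simpa using hf h
  simp only [h1, h2, false_or]

/-- Inserting an element of the pair `i` creates at most the full pair `i`. -/
lemma bookFull_insert_some_subset (hf : Function.Injective f) (I : Set α) (i : Fin k) (b : Bool) :
    bookFull f (insert (f (some (i, b))) I) ⊆ insert i (bookFull f I) := by
  intro j hj
  rw [mem_bookFull, Set.mem_insert_iff, Set.mem_insert_iff] at hj
  rw [Finset.mem_insert, mem_bookFull]
  by_cases hij : j = i
  · exact Or.inl hij
  · right
    have h1 : f (some (j, false)) ≠ f (some (i, b)) := fun h => hij (by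
      have := hf h
      simp only [Option.some.injEq, Prod.mk.injEq] at this
      exact this.1)
    have h2 : f (some (j, true)) ≠ f (some (i, b)) := fun h => hij (by
      have := hf h
      simp only [Option.some.injEq, Prod.mk.injEq] at this
      exact this.1)
    exact ⟨hj.1.resolve_left h1, hj.2.resolve_left h2⟩

/-- Inserting an element keeps the full pairs. -/
lemma bookFull_subset_insert (I : Set α) (e : α) : bookFull f I ⊆ bookFull f (insert e I) :=
  bookFull_mono f (Set.subset_insert _ _)

/-- If the pair `i` is full after inserting one of its elements, the other element was already there. -/
lemma mem_of_mem_bookFull_insert (hf : Function.Injective f) {I : Set α} {i : Fin k} {b : Bool}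
    (h : i ∈ bookFull f (insert (f (some (i, b))) I)) : f (some (i, !b)) ∈ I := by
  rw [mem_bookFull, Set.mem_insert_iff, Set.mem_insert_iff] at h
  have hne : f (some (i, !b)) ≠ f (some (i, b)) := fun h' => by
    have := hf h'
    simp only [Option.some.injEq, Prod.mk.injEq, true_and] at this
    exact Bool.not_ne_self b this
  cases b
  · exact h.2.resolve_left hne
  · exact h.1.resolve_left hne

/-! ## The independence axioms -/

/-- The empty set is independent. -/
lemma bookIndep_empty : BookIndep f ∅ := by
  refine ⟨Set.empty_subset _, ?_⟩
  have h1 : bookSp f ∅ = 0 := (bookSp_eq_zero_iff f ∅).2 (Set.notMem_empty _)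
  have h2 : bookFull f ∅ = ∅ := by
    ext i; simp [mem_bookFull]
  rw [h1, h2, Finset.card_empty]
  omega

/-- Independence is closed under subsets. -/
lemma bookIndep_subset {I J : Set α} (hJ : BookIndep f J) (hIJ : I ⊆ J) : BookIndep f I :=
  ⟨hIJ.trans hJ.1, by
    have := Finset.card_le_card (bookFull_mono f hIJ)
    have := bookSp_mono f hIJ
    have := hJ.2
    omega⟩

/-- An independent set lies in the ground set `range f`. -/
lemma bookIndep_subset_range {I : Set α} (hI : BookIndep f I) : I ⊆ Set.range f := hI.1

/-- **The augmentation axiom**: if the count of `I` is `0` any element of `J ∖ I` can be added; if it is `1` and no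
element can be added, `J` hits only pairs hit by `I` and `|J| ≤ |I|`. -/
lemma bookIndep_aug (hf : Function.Injective f) {I J : Set α} (hI : BookIndep f I) (hJ : BookIndep f J)
    (hIJ : I.ncard < J.ncard) : ∃ e ∈ J, e ∉ I ∧ BookIndep f (insert e I) := by
  classical
  have hfinJ : J.Finite := (Set.finite_range f).subset hJ.1
  have hfinI : I.Finite := (Set.finite_range f).subset hI.1
  obtain ⟨hIr, hIc⟩ := hI
  obtain ⟨hJr, hJc⟩ := hJ
  -- an element of `J ∖ I` exists
  obtain ⟨e₁, he₁J, he₁I⟩ : ∃ e ∈ J, e ∉ I := by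
    by_contra hcon
    have hJI : J ⊆ I := fun e he => by
      by_contra he'
      exact hcon ⟨e, he, he'⟩
    exact absurd (Set.ncard_le_ncard hJI hfinI) (not_le.2 hIJ)
  rcases Nat.eq_zero_or_pos (bookSp f I + (bookFull f I).card) with h0 | hpos
  · -- nothing to lose: any element of `J ∖ I` keeps the count `≤ 1`
    refine ⟨e₁, he₁J, he₁I, Set.insert_subset (hJr he₁J) hIr, ?_⟩
    obtain ⟨x, rfl⟩ := hJr he₁J
    rcases x with _ | ⟨i, b⟩
    · rw [bookSp_insert_none, bookFull_insert_none f hf]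
      omega
    · have hne : f (some (i, b)) ≠ f none := fun h => by simpa using hf h
      rw [bookSp_insert_of_ne f hne]
      have := Finset.card_le_card (bookFull_insert_some_subset f hf I i b)
      have := Finset.card_insert_le i (bookFull f I)
      omega
  · -- the count is exactly one; if no insertion works, `J` hits only pairs hit by `I` and `|J| ≤ |I|`
    have h1 : bookSp f I + (bookFull f I).card = 1 := by omega
    by_contra hcon
    have hdep : ∀ e ∈ J, e ∉ I → 2 ≤ bookSp f (insert e I) + (bookFull f (insert e I)).card := by
      intro e heJ heI
      by_contra hlt
      exact hcon ⟨e, heJ, heI, Set.insert_subset (hJr heJ) hIr, by omega⟩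
    have hhit : bookHit f J ⊆ bookHit f I := by
      intro i hi
      rw [mem_bookHit] at hi
      -- pick an element of `J` in the pair `i`
      obtain ⟨b, hb⟩ : ∃ b : Bool, f (some (i, b)) ∈ J := by
        rcases hi with h | h
        · exact ⟨false, h⟩
        · exact ⟨true, h⟩
      by_cases hbI : f (some (i, b)) ∈ I
      · rw [mem_bookHit]
        cases b
        · exact Or.inl hbI
        · exact Or.inr hbI
      · have h2 := hdep _ hb hbI
        have hne : f (some (i, b)) ≠ f none := fun h => by simpa using hf h
        rw [bookSp_insert_of_ne f hne] at h2
        have hsub := bookFull_insert_some_subset f hf I i b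
        have hcard := Finset.card_le_card hsub
        have hins := Finset.card_insert_le i (bookFull f I)
        -- so `i` is full after the insertion: the other element of the pair lies in `I`
        have hiF : i ∈ bookFull f (insert (f (some (i, b))) I) := by
          by_contra hiF
          have : bookFull f (insert (f (some (i, b))) I) ⊆ bookFull f I := by
            intro j hj
            have := hsub hj
            rw [Finset.mem_insert] at this
            rcases this with rfl | h
            · exact absurd hj hiF
            · exact h
          have := Finset.card_le_card this
          omega
        have hother := mem_of_mem_bookFull_insert f hf hiF
        rw [mem_bookHit]
        cases b
        · exact Or.inr hother
        · exact Or.inl hother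
    have hJcard := ncard_eq_pattern f hf hJr
    have hIcard := ncard_eq_pattern f hf hIr
    have := Finset.card_le_card hhit
    omega

/-- **The book matroid** `B_k` on `range f` (an `abbrev`, so that Mathlib's `IndepMatroid.ofFinite_finite` instance
is found for it). -/
noncomputable abbrev book (hf : Function.Injective f) : Matroid α :=
  (IndepMatroid.ofFinite (Set.finite_range f) (BookIndep f) (bookIndep_empty f)
    (fun _ _ hJ hIJ => bookIndep_subset f hJ hIJ) (fun _ _ hI hJ hIJ => bookIndep_aug f hf hI hJ hIJ)
    (fun _ hI => bookIndep_subset_range f hI)).matroid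

/-- The ground set of the book is `range f`. -/
lemma book_ground (hf : Function.Injective f) : (book f hf).E = Set.range f := rfl

/-- Independence in the book is `BookIndep`. -/
lemma book_indep_iff (hf : Function.Injective f) {I : Set α} : (book f hf).Indep I ↔ BookIndep f I := Iff.rfl

/-- The book is a finite matroid (Mathlib's instance for `IndepMatroid.ofFinite`, found through the `abbrev`). -/
lemma book_finite (hf : Function.Injective f) : (book f hf).Finite := inferInstance

end PercRepro.RankDist
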